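/-
Literature/NumberTheory/ComplexMultiplication/DegenerateCMTypesAbelianKernelsIndexFourSquarefree.lean — pub-hodgecm2 (COR-CM), KEPT Literature
lane lit-deligne-3 gen 65, file F65f.  THEOREMS ONLY (no `def`, no named fact, no `sorry`, no instance, no notation; D-0026 net debt 0).
HC_CM is NOT proved.
-/
import Literature.NumberTheory.ComplexMultiplication.DegenerateCMTypesAbelianKernels
import Literature.NumberTheory.ComplexMultiplication.DegenerateCMTypesAbelianPrimePower
import Literature.NumberTheory.NumberFields.VanishingSumsRootsOfUnitySquarefree
import HarnessLib

/-!
# Kernels of index `4p₁⋯p_k` with CYCLIC quotient in a finite abelian group (`p_i` pairwise distinct ODD primes, `k ≥ 1`): the characters vanish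
# on a CM type iff the `k`-th MIXED DIFFERENCES of its coset counts along the odd part vanish — Gaussian-integer relations among roots of unity of
# squarefree odd order

Topic `Literature/NumberTheory/ComplexMultiplication` (namespace `Literature.NumberTheory.ComplexMultiplication.CyclicCMType{,.AbelianKernels}`); cell
`pub-hodgecm2` (COR-CM), KEPT Literature lane `lit-deligne-3` gen 65, file F65f — the second kernel decision of the lane's SQUAREFREE-ODD-PART programme:
index `4m`, `m` odd squarefree, for ANY finite abelian group (the `2`-part of exponent `4`), over F65e (index `2m`) exactly as the lane's F65b (index
`4pq`) sits over F64i (index `2pq`).  KERNEL ONLY: theorems; no `def`, no named fact, no instance, no notation (D-0014 ∕ D-0026 net debt `0`).  HC_CM is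
NOT proved here or anywhere in the lane.

## Mathematics

Kubota's count of the rank of a CM type `S ⊂ G` [Kubota1965, §4 Lemma 2] regrouped by kernels needs, for each admissible kernel `H` (`ρ ∉ H`, `G/H`
cyclic), a criterion for `χ(S) = 0`, `ker χ = H`.  For `[G:H] = 4m`, `m = p₁⋯p_k` (pairwise distinct odd primes) and `G/H` CYCLIC, pick `w, u_i ∈ G`
with `χ(w) = i`, `χ(u_i) = μ_i` primitive of order `p_i` (`w = σ^{m}` or `σ^{3m}`, `u_i = σ^{4m/p_i}` for a generator `σ`).  Every value of `χ` is
`i^e Πμ_i^{x_i}` (`e ∈ ℤ/4`, `x ∈ Πℤ/p_i`; the parametrisation `ℤ/4 × Πℤ/p_i → G/H` is a bijection), and F. Hazama's computation [Hazama2003CyclicCM]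
(4.1) with multiplicities gives the GAUSSIAN decomposition

  `χ(S) = V(E₀) + i·V(E₁)`,  `V(E) = Σ_x E(x) Πμ_i^{x_i}`,  `E_e(x) = N(i^eΠμ^x) − N(i^{e+2}Πμ^x) = 2N(i^eΠμ^x) − |H|`

(`N(z) = #{s ∈ S : χ(s) = z}`, `S ⊔ ρS = G`).  Since `i ∉ ℚ(ζ_m)` for odd `m` ([Washington1997] Prop. 2.4, Thm. 2.5: `[ℚ(ζ_{4m}):ℚ] = 2φ(m) > φ(m)`;
**`I_notMem_adjoin_of_coprime_two`**) and `V(E_e) ∈ ℚ(ζ_m)`, `χ(S) = 0 ⟺ V(E₀) = V(E₁) = 0` (**`sum_add_I_mul_sum_eq_zero_iff_alternatingSum`**), and by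
the Rédei ∕ de Bruijn ∕ Schoenberg criterion of the lane's F65d ([LamLeung2000] Thm. 2.2) each vanishes iff the `k`-th mixed differences of `E_e` —
equivalently of the counts `N(i^e ·)`, as `Σ_ε (−1)^{|ε|} = 0` — vanish; the base points `e = 2, 3` follow from `e = 0, 1` by complementarity.  Hence
(**`sum_char_eq_zero_iff_alternatingSum_of_index_four_mul_squarefree`**):

  `χ(S) = 0 ⟺ Σ_{ε ∈ {0,1}^k} (−1)^{|ε|} #(S ∩ g·x₁^{ε₁}⋯x_k^{ε_k}·H) = 0`  for all `g ∈ G` and all `x_i ∈ G` with `x_i^{p_i} ∈ H`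

— VERBATIM the index-`2m` condition (F65e), now from every base point of `ℤ/4 × Πℤ/p_i`; and the all-characters form
**`forall_sum_char_eq_zero_iff_alternatingSum_of_index_four_mul_squarefree`** (the kernel contributes `φ(4m) = 2Π(p_i − 1)` to Kubota's defect iff so).

* §1 (`namespace CyclicCMType`, section Gaussian): private `isPrimitiveRoot_I_four_fs`; **`I_notMem_adjoin_of_coprime_two`** (`i ∉ ℚ(ν)`, `ν` primitive
  of order `m` prime to `2`), `eq_zero_of_add_I_mul_eq_zero_of_coprime_two`, **`sum_add_I_mul_sum_eq_zero_iff_alternatingSum`** (Gaussian coordinates of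
  a relation: both rational coordinates satisfy F65d's criterion; membership `V(f) ∈ ℚ(Πμ_i)` by F65d's `mem_adjoin_prod`).
* §0 ∕ §2 (`namespace AbelianKernels`): private helpers (suffix `_fs`; `exists_values_family_fs` gives the `u_i` and `w`, **`coords_eq_of_value_eq_fs`** is
  the cancellation in `μ₄·Πμ_{p_i}` by the power `4Π_{j≠i}p_j`), the parametrisation and fibre sum (`Finset.sum_fiberwise_of_maps_to`, the tree's
  `AbelianPrimePow.card_filter_neg`, `card_fibre_mul`), the Gaussian decomposition over `Fin 4`, §1, and the dictionary value counts ↔ coset counts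
  (`χ(g·Π_{ε_i}x_i) = i^e Πμ_i^{a_i + ε_i d_i}`).
* §3 (gen 65 append) the same two theorems for prime families indexed by an arbitrary finite type `ι` (`…_fintype`; transport along
  `Fintype.equivFin ι`) — the form used with `ι = ↥J`, `J` a set of prime divisors of the exponent.

PRESEARCH (lane rule): as for F65b ∕ F65e — Hazama's Lemma 4.6.1 (tree) is the `±1`, one-prime case and cites Schoenberg (4.6); the relation theorem is
[corpus: paper:arxiv-math_9511209 = LamLeung2000, chunk p0034, Thm. 2.2] (typed in F65d); `i ∉ ℚ(ζ_m)` is [Washington1997] Prop. 2.4 (held book,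
Ch. 2); the Gaussian ∕ mixed-difference form of the CM-type criterion at index `4m` is not found as printed (corpus hybrid + galaxy «degenerate CM type |
rank of a CM-type | index of degeneracy», all stars: 0 relevant, earlier lane queries); recorded as the lane's own elementary theorem with those citations.

HONEST REGISTER.  Unconditional and elementary; nothing about degenerate types' Hodge classes.  The quotient must be CYCLIC (index `4m` subgroups with
quotient `ℤ/2 × ℤ/2m` carry no character of that kernel); prime powers in `m` and `2`-parts `≥ 8` are not treated.  HC_CM is NOT proved and not used.

## References

* [Hazama2003CyclicCM] F. Hazama, *Hodge cycles on abelian varieties with complex multiplication by cyclic CM-fields*, J. Math. Sci. Univ. Tokyo 10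
  (2003) 581–598: (4.1), Prop. 4.1, 4.3, Lemma 4.6.1 with (4.6)–(4.10), Thm. 4.8.
* [Kubota1965] T. Kubota, *On the field extension by complex multiplication*, Trans. AMS 118 (1965), §4 Lemma 2.
* [White1993SporadicCycles] S. P. White, *Sporadic cycles on CM abelian varieties*, Compositio Math. 88 (1993), §4, proof of Lemma 3 (p. 131).
* [Washington1997] L. C. Washington, *Introduction to Cyclotomic Fields*, 2nd ed., GTM 83, Ch. 2: Prop. 2.4, Thm. 2.5.
* [LamLeung2000] T. Y. Lam, K. H. Leung, *On vanishing sums of roots of unity*, J. Algebra 224 (2000), Thm. 2.2 (via the lane's F65d).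

## Provenance

Cell `pub-hodgecm2` (COR-CM), KEPT Literature lane `lit-deligne-3` gen 65 (claim ABELIAN-KERNELS-INDEX-4SQUAREFREE; count-neutral, own lane), file F65f;
neighbours cited by name, nothing restated: `DegenerateCMTypesAbelianKernels` (`forall_sum_char_eq_zero_iff_exists`, `exists_oddChar_ker`),
`DegenerateCMTypesAbelianPrimePower` (`AbelianPrimePow.card_filter_neg`, `card_fibre_mul`), `NumberFields/CyclotomicGaussianIndependence`
(`finrank_adjoin_eq_totient`), `NumberFields/VanishingSumsRootsOfUnitySquarefree` (F65d: the criterion, `isPrimitiveRoot_prod`, `mem_adjoin_prod`).  The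
proof text follows the lane's F65b (`k = 2`) with families `Fin k → _` throughout (and F65e for the family bookkeeping).  The `[folklore]` helpers are
private.  Theorems only; net Literature debt 0.
-/

noncomputable section

open scoped BigOperators Classical

namespace Literature.NumberTheory.ComplexMultiplication

namespace CyclicCMType

open IntermediateField
open Literature.NumberTheory.NumberFields.CyclotomicGaussian (finrank_adjoin_eq_totient)
open Literature.NumberTheory.NumberFields.VanishingSumsSquarefree
  (sum_mul_prod_pow_eq_zero_iff_forall_alternatingSum_eq_zero isPrimitiveRoot_prod mem_adjoin_prod)

/-! ## §1 `i ∉ ℚ(ζ_m)` for odd `m`, and the Gaussian coordinates of a relation -/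

section Gaussian

/-- `i` is a primitive fourth root of unity. [folklore] -/
private theorem isPrimitiveRoot_I_four_fs : IsPrimitiveRoot Complex.I 4 := by
  refine IsPrimitiveRoot.mk_of_lt Complex.I (by norm_num) Complex.I_pow_four fun l hl hl4 => ?_
  interval_cases l
  · rw [pow_one]; intro h; simpa using congrArg Complex.im h
  · rw [Complex.I_sq]; intro h; have := congrArg Complex.re h; norm_num at this
  · rw [pow_succ, Complex.I_sq]; intro h; simpa using congrArg Complex.im h

/-- **`i ∉ ℚ(ν)`** for a primitive `m`-th root of unity `ν` with `m` ODD: else `ℚ(ζ_{4m}) = ℚ(iν) ⊆ ℚ(ν)` and `2φ(m) = φ(4m) ≤ φ(m)`.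
(`m` prime: the tree's `CyclotomicGaussian.I_notMem_adjoin`; two primes: the lane's `I_notMem_sup_adjoin`.) [cite: Washington1997, Prop. 2.4 and Thm. 2.5] -/
theorem I_notMem_adjoin_of_coprime_two {m : ℕ} (hm : 0 < m) (h2m : Nat.Coprime 2 m) {ν : ℂ} (hν : IsPrimitiveRoot ν m) :
    Complex.I ∉ ℚ⟮ν⟯ := by
  intro hI
  have hcop4 : Nat.Coprime 4 m := by
    rw [show (4 : ℕ) = 2 ^ 2 by norm_num]
    exact h2m.pow_left 2
  have hη : IsPrimitiveRoot (Complex.I * ν) (4 * m) := by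
    have h4 : orderOf Complex.I = 4 := isPrimitiveRoot_I_four_fs.eq_orderOf.symm
    have hmo : orderOf ν = m := hν.eq_orderOf.symm
    rw [IsPrimitiveRoot.iff_orderOf, (Commute.all _ _).orderOf_mul_eq_mul_orderOf_of_coprime (by rw [h4, hmo]; exact hcop4), h4, hmo]
  haveI : FiniteDimensional ℚ ℚ⟮ν⟯ := adjoin.finiteDimensional ((hν.isIntegral hm).tower_top)
  have hle : ℚ⟮Complex.I * ν⟯ ≤ ℚ⟮ν⟯ := adjoin_simple_le_iff.2 (mul_mem hI (mem_adjoin_simple_self ℚ ν))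
  have h4 : Nat.totient 4 = 2 := by decide
  have h := finrank_le_of_le_right hle
  rw [finrank_adjoin_eq_totient (Nat.mul_pos four_pos hm) hη, Nat.totient_mul hcop4, h4, finrank_adjoin_eq_totient hm hν] at h
  have h1 : 1 ≤ Nat.totient m := Nat.totient_pos.2 hm
  omega

/-- `a + i·b = 0` with `a, b ∈ ℚ(ν)` (`m` odd) forces `a = b = 0`. [cite: Washington1997, Prop. 2.4] -/
theorem eq_zero_of_add_I_mul_eq_zero_of_coprime_two {m : ℕ} (hm : 0 < m) (h2m : Nat.Coprime 2 m) {ν : ℂ}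
    (hν : IsPrimitiveRoot ν m) {a b : ℂ} (ha : a ∈ ℚ⟮ν⟯) (hb : b ∈ ℚ⟮ν⟯) (h : a + Complex.I * b = 0) : a = 0 ∧ b = 0 := by
  by_cases hb0 : b = 0
  · refine ⟨?_, hb0⟩
    rwa [hb0, mul_zero, add_zero] at h
  · exfalso
    apply I_notMem_adjoin_of_coprime_two hm h2m hν
    have hI : Complex.I = -a / b := by
      field_simp
      linear_combination h
    rw [hI]
    exact div_mem (neg_mem ha) hb

/-- **Gaussian coordinates of a relation of squarefree odd order**: for pairwise distinct ODD primes `p_i`, primitive roots `μ_i` and rational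
`f₀, f₁`, `Σ_x f₀(x)Πμ_i^{x_i} + i·Σ_x f₁(x)Πμ_i^{x_i} = 0` iff BOTH `f₀` and `f₁` have vanishing `k`-th mixed differences (`i ∉ ℚ(ζ_{p₁⋯p_k})`, and
the lane's F65d criterion for each coordinate). [cite: Washington1997, Prop. 2.4 and Thm. 2.5] [cite: LamLeung2000, Thm. 2.2] -/
theorem sum_add_I_mul_sum_eq_zero_iff_alternatingSum {k : ℕ} {p : Fin k → ℕ} [∀ i, NeZero (p i)] (hp : ∀ i, (p i).Prime)
    (hinj : Function.Injective p) (hodd : ∀ i, p i ≠ 2) {μ : Fin k → ℂ} (hμ : ∀ i, IsPrimitiveRoot (μ i) (p i))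
    (f₀ f₁ : (Π i, ZMod (p i)) → ℚ) :
    (∑ x : (Π i, ZMod (p i)), algebraMap ℚ ℂ (f₀ x) * ∏ i, μ i ^ (x i).val) +
        Complex.I * ∑ x : (Π i, ZMod (p i)), algebraMap ℚ ℂ (f₁ x) * ∏ i, μ i ^ (x i).val = 0 ↔
      (∀ x d : (Π i, ZMod (p i)),
          ∑ ε : Fin k → Bool, (∏ i, (if ε i then (-1 : ℚ) else 1)) * f₀ (fun i => if ε i then x i + d i else x i) = 0) ∧
        ∀ x d : (Π i, ZMod (p i)),
          ∑ ε : Fin k → Bool, (∏ i, (if ε i then (-1 : ℚ) else 1)) * f₁ (fun i => if ε i then x i + d i else x i) = 0 := by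
  rw [← sum_mul_prod_pow_eq_zero_iff_forall_alternatingSum_eq_zero k p μ hp hinj hμ f₀,
    ← sum_mul_prod_pow_eq_zero_iff_forall_alternatingSum_eq_zero k p μ hp hinj hμ f₁]
  have hν := isPrimitiveRoot_prod k p μ hp hinj hμ
  have hm : 0 < ∏ i, p i := Finset.prod_pos fun i _ => (hp i).pos
  have h2m : Nat.Coprime 2 (∏ i, p i) :=
    Nat.Coprime.prod_right fun i _ => (Nat.coprime_primes Nat.prime_two (hp i)).2 (Ne.symm (hodd i))
  have hmemμ : ∀ j, μ j ∈ ℚ⟮∏ i, μ i⟯ := mem_adjoin_prod k p μ hp hinj hμ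
  have hmem : ∀ f : (Π i, ZMod (p i)) → ℚ,
      (∑ x : (Π i, ZMod (p i)), algebraMap ℚ ℂ (f x) * ∏ i, μ i ^ (x i).val) ∈ ℚ⟮∏ i, μ i⟯ := fun f =>
    sum_mem fun x _ => mul_mem (IntermediateField.algebraMap_mem _ _) (prod_mem fun i _ => pow_mem (hmemμ i) _)
  constructor
  · intro h0
    exact eq_zero_of_add_I_mul_eq_zero_of_coprime_two hm h2m hν (hmem f₀) (hmem f₁) h0
  · rintro ⟨h0, h1⟩
    rw [h0, h1, mul_zero, add_zero]

end Gaussian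

namespace AbelianKernels

variable {G : Type*} [CommGroup G] [Fintype G] [DecidableEq G] {ρ : G} {Φ : Finset G}

/-! ## §0 Helpers -/

section Helpers

omit [Fintype G] [DecidableEq G] in
/-- `χ(gh) = χ(g)χ(h)`. [folklore] -/
private theorem char_mul_fs (χ : AddChar (Additive G) ℂ) (g h : G) :
    χ (Additive.ofMul (g * h)) = χ (Additive.ofMul g) * χ (Additive.ofMul h) := by
  rw [ofMul_mul, AddChar.map_add_eq_mul]

omit [Fintype G] [DecidableEq G] in
/-- `χ(g^e) = χ(g)^e`. [folklore] -/
private theorem char_pow_fs (χ : AddChar (Additive G) ℂ) (g : G) (e : ℕ) :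
    χ (Additive.ofMul (g ^ e)) = χ (Additive.ofMul g) ^ e := by
  rw [ofMul_pow, AddChar.map_nsmul_eq_pow]

omit [Fintype G] [DecidableEq G] in
/-- `χ(1) = 1`. [folklore] -/
private theorem char_one_fs (χ : AddChar (Additive G) ℂ) : χ (Additive.ofMul (1 : G)) = 1 := by
  rw [ofMul_one, AddChar.map_zero_eq_one]

omit [Fintype G] [DecidableEq G] in
/-- `χ(Π g_i) = Π χ(g_i)`. [folklore] -/
private theorem char_prod_fs {ι : Type*} (χ : AddChar (Additive G) ℂ) (s : Finset ι) (g : ι → G) :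
    χ (Additive.ofMul (∏ i ∈ s, g i)) = ∏ i ∈ s, χ (Additive.ofMul (g i)) := by
  induction s using Finset.induction_on with
  | empty => rw [Finset.prod_empty, Finset.prod_empty, char_one_fs]
  | insert a s ha ih => rw [Finset.prod_insert ha, Finset.prod_insert ha, char_mul_fs, ih]

omit [Fintype G] [DecidableEq G] in
/-- `χ(g) ≠ 0`. [folklore] -/
private theorem char_ne_zero_fs (χ : AddChar (Additive G) ℂ) (g : G) : χ (Additive.ofMul g) ≠ 0 := by
  intro h0
  have := char_mul_fs χ g g⁻¹
  rw [mul_inv_cancel, char_one_fs, h0, zero_mul] at this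
  exact one_ne_zero this

omit [Fintype G] [DecidableEq G] in
/-- `χ(s) = χ(g)` iff `g⁻¹s ∈ ker χ`. [folklore] -/
private theorem char_eq_iff_inv_mul_mem_fs {H : Subgroup G} (χ : AddChar (Additive G) ℂ)
    (hker : ∀ g : G, χ (Additive.ofMul g) = 1 ↔ g ∈ H) (g s : G) :
    χ (Additive.ofMul s) = χ (Additive.ofMul g) ↔ g⁻¹ * s ∈ H := by
  rw [← hker]
  have h1 : χ (Additive.ofMul (g⁻¹ * s)) * χ (Additive.ofMul g) = χ (Additive.ofMul s) := by
    rw [← char_mul_fs, mul_comm g⁻¹ s, inv_mul_cancel_right]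
  constructor
  · intro hs
    rw [hs] at h1
    exact mul_left_eq_self₀.1 h1 |>.resolve_right (char_ne_zero_fs χ g)
  · intro h
    rw [h, one_mul] at h1
    exact h1.symm

omit [Fintype G] [DecidableEq G] in
/-- `ρ² = 1` for the conjugation of a CM type. [folklore] -/
private theorem rho_mul_rho_fs (h : IsCMTypeWith ρ (Φ : Set G)) : ρ * ρ = 1 := by
  simpa [smul_eq_mul] using h.invol (1 : G)

omit [Fintype G] [DecidableEq G] in
/-- A character whose kernel misses the involution `ρ` is odd. [folklore] -/
private theorem odd_of_ker_fs {H : Subgroup G} (hρH : ρ ∉ H) (hρ2 : ρ * ρ = 1) (χ : AddChar (Additive G) ℂ)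
    (hker : ∀ g : G, χ (Additive.ofMul g) = 1 ↔ g ∈ H) : χ (Additive.ofMul ρ) = -1 := by
  have hsq : χ (Additive.ofMul ρ) * χ (Additive.ofMul ρ) = 1 := by rw [← char_mul_fs, hρ2, char_one_fs]
  rcases mul_self_eq_one_iff.1 hsq with h1 | h1
  · exact absurd ((hker ρ).1 h1) hρH
  · exact h1

omit [Fintype G] [DecidableEq G] in
/-- For `ker χ` of index `4·p₁⋯p_k` with cyclic quotient: elements `u_i` with `χ(u_i)` primitive of order `p_i`, and `w` with `χ(w) = i`.
[folklore] -/
private theorem exists_values_family_fs [Finite G] {k : ℕ} {p : Fin k → ℕ} (hp : ∀ i, (p i).Prime) {H : Subgroup G}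
    (χ : AddChar (Additive G) ℂ) (hker : ∀ g : G, χ (Additive.ofMul g) = 1 ↔ g ∈ H) (hidx : H.index = 4 * ∏ i, p i)
    (hcyc : IsCyclic (G ⧸ H)) :
    (∃ u : Fin k → G, ∀ i, IsPrimitiveRoot (χ (Additive.ofMul (u i))) (p i)) ∧ ∃ w : G, χ (Additive.ofMul w) = Complex.I := by
  haveI := hcyc
  obtain ⟨γ, hγ⟩ := IsCyclic.exists_generator (α := G ⧸ H)
  obtain ⟨σ, rfl⟩ := QuotientGroup.mk_surjective γ
  have hσN : orderOf (σ : G ⧸ H) = 4 * ∏ i, p i := by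
    rw [orderOf_eq_card_of_forall_mem_zpowers hγ, ← Subgroup.index_eq_card, hidx]
  have hprim : IsPrimitiveRoot (χ (Additive.ofMul σ)) (4 * ∏ i, p i) := by
    rw [IsPrimitiveRoot.iff_def]
    have hk : ∀ n : ℕ, χ (Additive.ofMul σ) ^ n = 1 ↔ 4 * ∏ i, p i ∣ n := fun n => by
      rw [← char_pow_fs, hker, ← QuotientGroup.eq_one_iff, QuotientGroup.mk_pow, ← hσN, orderOf_dvd_iff_pow_eq_one]
    exact ⟨(hk _).2 dvd_rfl, fun l hl => (hk l).1 hl⟩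
  have hpos : 0 < 4 * ∏ i, p i := Nat.mul_pos four_pos (Finset.prod_pos fun i _ => (hp i).pos)
  refine ⟨⟨fun i => σ ^ (4 * ∏ j ∈ Finset.univ.erase i, p j), fun i => ?_⟩, ?_⟩
  · rw [char_pow_fs]
    exact hprim.pow hpos (by rw [mul_assoc, Finset.prod_erase_mul _ _ (Finset.mem_univ i)])
  · have hε4 : IsPrimitiveRoot (χ (Additive.ofMul σ) ^ (∏ i, p i)) 4 := hprim.pow hpos (by ring)
    have hne : (χ (Additive.ofMul σ) ^ (∏ i, p i)) ^ 2 ≠ 1 := hε4.pow_ne_one_of_pos_of_lt two_ne_zero (by norm_num)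
    have hsq4 : (χ (Additive.ofMul σ) ^ (∏ i, p i)) ^ 2 * (χ (Additive.ofMul σ) ^ (∏ i, p i)) ^ 2 = 1 := by
      rw [← pow_add]
      exact hε4.pow_eq_one
    have hε2 : (χ (Additive.ofMul σ) ^ (∏ i, p i)) ^ 2 = -1 := (mul_self_eq_one_iff.1 hsq4).resolve_left hne
    have h0 : (χ (Additive.ofMul σ) ^ (∏ i, p i) - Complex.I) * (χ (Additive.ofMul σ) ^ (∏ i, p i) + Complex.I) = 0 := by
      linear_combination hε2 - Complex.I_sq
    rcases mul_eq_zero.1 h0 with h1 | h1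
    · exact ⟨σ ^ (∏ i, p i), by rw [char_pow_fs, sub_eq_zero.1 h1]⟩
    · refine ⟨σ ^ (3 * ∏ i, p i), ?_⟩
      rw [char_pow_fs, pow_mul', eq_neg_of_add_eq_zero_left h1, neg_pow, Complex.I_pow_three]
      norm_num

/-- `ω^{(x + y).val} = ω^{x.val} ω^{y.val}` for `ω` a primitive `n`-th root of unity. [folklore] -/
private theorem pow_val_add_fs {n : ℕ} [NeZero n] {ω : ℂ} (hω : IsPrimitiveRoot ω n) (x y : ZMod n) :
    ω ^ (x + y).val = ω ^ x.val * ω ^ y.val := by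
  have h1 := pow_mod_orderOf ω (x.val + y.val)
  rw [← hω.eq_orderOf] at h1
  rw [ZMod.val_add, h1, pow_add]

/-- **Cancellation in `μ₄ · μ_{p₁} ⋯ μ_{p_k}`**: `i^e Π μ_i^{x_i} = i^{e'} Π μ_i^{x'_i}` forces `x = x'` (raise to the power `4·Π_{j ≠ i} p_j`).
[folklore] -/
private theorem coords_eq_of_value_eq_fs {k : ℕ} {p : Fin k → ℕ} [∀ i, NeZero (p i)] (hp : ∀ i, (p i).Prime)
    (hinj : Function.Injective p) (hodd : ∀ i, p i ≠ 2) {μ : Fin k → ℂ} (hμ : ∀ i, IsPrimitiveRoot (μ i) (p i))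
    {e e' : ℕ} {x x' : Π i, ZMod (p i)}
    (h : Complex.I ^ e * ∏ i, μ i ^ (x i).val = Complex.I ^ e' * ∏ i, μ i ^ (x' i).val) : x = x' := by
  funext i
  set N : ℕ := 4 * ∏ j ∈ Finset.univ.erase i, p j with hN
  have hkill : ∀ (f : ℕ) (y : Π i, ZMod (p i)), (Complex.I ^ f * ∏ j, μ j ^ (y j).val) ^ N = μ i ^ (N * (y i).val) := by
    intro f y
    have A : (Complex.I ^ f) ^ N = 1 := by
      rw [hN, ← pow_mul, show f * (4 * ∏ j ∈ Finset.univ.erase i, p j) = 4 * (f * ∏ j ∈ Finset.univ.erase i, p j) by ring,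
        pow_mul, Complex.I_pow_four, one_pow]
    have B : (∏ j, μ j ^ (y j).val) ^ N = μ i ^ (N * (y i).val) := by
      rw [← Finset.prod_pow, Finset.prod_eq_single i]
      · rw [← pow_mul, mul_comm]
      · intro j _ hji
        have hsplit : p j * ∏ l ∈ (Finset.univ.erase i).erase j, p l = ∏ l ∈ Finset.univ.erase i, p l :=
          Finset.mul_prod_erase _ _ (Finset.mem_erase.2 ⟨hji, Finset.mem_univ j⟩)
        rw [← pow_mul, hN, ← hsplit, show (y j).val * (4 * (p j * ∏ l ∈ (Finset.univ.erase i).erase j, p l)) =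
            p j * (4 * (y j).val * ∏ l ∈ (Finset.univ.erase i).erase j, p l) by ring, pow_mul, (hμ j).pow_eq_one, one_pow]
      · intro hi; exact absurd (Finset.mem_univ i) hi
    rw [mul_pow, A, B, one_mul]
  have h2 : μ i ^ (N * (x i).val) = μ i ^ (N * (x' i).val) := by rw [← hkill e x, ← hkill e' x', h]
  have hpi := hp i
  have hmod : N * (x i).val ≡ N * (x' i).val [MOD p i] := by
    have h1 := pow_mod_orderOf (μ i) (N * (x i).val)
    have h1' := pow_mod_orderOf (μ i) (N * (x' i).val)
    rw [← (hμ i).eq_orderOf] at h1 h1'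
    rw [← h1, ← h1'] at h2
    exact (hμ i).pow_inj (Nat.mod_lt _ hpi.pos) (Nat.mod_lt _ hpi.pos) h2
  have hz : ((N * (x i).val : ℕ) : ZMod (p i)) = ((N * (x' i).val : ℕ) : ZMod (p i)) :=
    (ZMod.natCast_eq_natCast_iff _ _ _).2 hmod
  push_cast at hz
  rw [ZMod.natCast_zmod_val, ZMod.natCast_zmod_val] at hz
  have hu : IsUnit ((N : ℕ) : ZMod (p i)) := by
    rw [ZMod.isUnit_iff_coprime, hN]
    refine Nat.Coprime.mul_left ?_ (Nat.Coprime.prod_left fun j hj => (Nat.coprime_primes (hp j) hpi).2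
        fun hji => (Finset.mem_erase.1 hj).1 (hinj hji))
    rw [show (4 : ℕ) = 2 ^ 2 by norm_num]
    exact ((Nat.coprime_primes Nat.prime_two hpi).2 (Ne.symm (hodd i))).pow_left 2
  exact hu.mul_left_cancel hz

/-- `Σ_{ε ∈ {0,1}^k} Π_i (±1) = 0` for `k ≥ 1`. [folklore] -/
private theorem sum_sign_eq_zero_fs {k : ℕ} (hk : 0 < k) :
    ∑ ε : Fin k → Bool, (∏ i, (if ε i then (-1 : ℚ) else 1)) = 0 := by
  rw [← Fintype.prod_sum fun (_ : Fin k) (b : Bool) => if b then (-1 : ℚ) else 1]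
  exact Finset.prod_eq_zero (Finset.mem_univ (⟨0, hk⟩ : Fin k)) (by rw [Fintype.sum_bool]; norm_num)

end Helpers

/-! ## §2 Kernels of index `4p₁⋯p_k` with cyclic quotient: the character sum as `V(E₀) + i·V(E₁)` and the vanishing criterion -/

section IndexFourSquarefree

/-- **VANISHING AT A KERNEL OF INDEX `4p₁⋯p_k` IS THE VANISHING OF THE `k`-TH MIXED DIFFERENCES OF THE COSET COUNTS** (any finite abelian
group `G ∋ ρ`; `p₁, …, p_k` pairwise distinct ODD primes, `k ≥ 1`): let `χ` be a character whose kernel `H ∌ ρ` has index `4p₁⋯p_k` and CYCLIC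
quotient, and `S` a CM type.  Then `χ(S) = 0` iff

  `Σ_{ε ∈ {0,1}^k} (−1)^{|ε|} #(S ∩ g·x₁^{ε₁}⋯x_k^{ε_k}·H) = 0`  for all `g ∈ G` and all `x_i` with `x_i^{p_i} ∈ H`

— VERBATIM the condition of the index-`2p₁⋯p_k` kernels (the lane's F65e), from every base point of `G/H ≅ ℤ/4 × Π ℤ/p_i`.  Mechanism: with
`χ(w) = i`, `χ(u_i) = μ_i`, every value is `i^e Πμ_i^{x_i}` and `χ(S) = V(E₀) + i·V(E₁)`, `E_e(x) = N(i^eΠμ^x) − N(−i^eΠμ^x)`; since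
`i ∉ ℚ(ζ_{p₁⋯p_k})` (§1) both Gaussian coordinates vanish, i.e. (F65d) `E₀` AND `E₁` have vanishing mixed differences; with `N(−z) = #χ⁻¹(z) − N(z)`
and `Σ_ε (−1)^{|ε|} = 0` this is the condition on the counts from the base points `1, w, w², w³`, hence from every base point.  (Two primes: the lane's
F65b; one prime: `…equidistributed_of_index_four_mul`.) [cite: Hazama2003CyclicCM, Prop. 4.1, Lemma 4.6.1 and Thm. 4.8]
[cite: Washington1997, Prop. 2.4 and Thm. 2.5] [cite: Kubota1965, §4 Lemma 2] [cite: LamLeung2000, Thm. 2.2] -/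
theorem sum_char_eq_zero_iff_alternatingSum_of_index_four_mul_squarefree {k : ℕ} {p : Fin k → ℕ} (hk : 0 < k)
    (hp : ∀ i, (p i).Prime) (hinj : Function.Injective p) (hodd : ∀ i, p i ≠ 2)
    (h : IsCMTypeWith ρ (Φ : Set G)) (χ : AddChar (Additive G) ℂ) {H : Subgroup G} (hρH : ρ ∉ H)
    (hker : ∀ g : G, χ (Additive.ofMul g) = 1 ↔ g ∈ H) (hidx : H.index = 4 * ∏ i, p i) (hcyc : IsCyclic (G ⧸ H)) :
    ∑ s ∈ Φ, χ (Additive.ofMul s) = 0 ↔ ∀ (g : G) (x : Fin k → G), (∀ i, x i ^ p i ∈ H) →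
      ∑ ε : Fin k → Bool, (∏ i, (if ε i then (-1 : ℤ) else 1)) *
        ((Φ.filter fun s => (g * ∏ i, (if ε i then x i else 1))⁻¹ * s ∈ H).card : ℤ) = 0 := by
  haveI : ∀ i, NeZero (p i) := fun i => ⟨(hp i).ne_zero⟩
  have hρ2 := rho_mul_rho_fs h
  have hχρ : χ (Additive.ofMul ρ) = -1 := odd_of_ker_fs hρH hρ2 χ hker
  obtain ⟨⟨u, hu⟩, ⟨w₄, hw₄⟩⟩ := exists_values_family_fs hp χ hker hidx hcyc
  -- the coset counts as value counts
  have hcos : ∀ g : G, (Φ.filter fun s => g⁻¹ * s ∈ H) =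
      Φ.filter fun s => χ (Additive.ofMul s) = χ (Additive.ofMul g) := fun g =>
    Finset.filter_congr fun s _ => (char_eq_iff_inv_mul_mem_fs χ hker g s).symm
  -- the values `χ(w^e Π u_i^{x_i}) = i^e Π μ_i^{x_i}`
  have hvalu : ∀ x : Π i, ZMod (p i), χ (Additive.ofMul (∏ i, u i ^ (x i).val)) =
      ∏ i, χ (Additive.ofMul (u i)) ^ (x i).val := fun x => by
    rw [char_prod_fs]
    exact Finset.prod_congr rfl fun i _ => char_pow_fs χ (u i) _
  have hval : ∀ (e : ℕ) (x : Π i, ZMod (p i)), χ (Additive.ofMul (w₄ ^ e * ∏ i, u i ^ (x i).val)) =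
      Complex.I ^ e * ∏ i, χ (Additive.ofMul (u i)) ^ (x i).val := fun e x => by
    rw [char_mul_fs, char_pow_fs, hw₄, hvalu]
  -- the fibre sizes over the values are all `M := #χ⁻¹(1)`, and `S` meets opposite fibres complementarily
  have hM : ∀ (e : ℕ) (x : Π i, ZMod (p i)),
      (Finset.univ.filter fun t : G => χ (Additive.ofMul t) = Complex.I ^ e * ∏ i, χ (Additive.ofMul (u i)) ^ (x i).val).card =
        (Finset.univ.filter fun t : G => χ (Additive.ofMul t) = 1).card := fun e x => by
    rw [← hval, ← AbelianPrimePow.card_fibre_mul χ (w₄ ^ e * ∏ i, u i ^ (x i).val) 1, mul_one]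
  have hle : ∀ (e : ℕ) (x : Π i, ZMod (p i)),
      (Φ.filter fun s => χ (Additive.ofMul s) = Complex.I ^ e * ∏ i, χ (Additive.ofMul (u i)) ^ (x i).val).card ≤
        (Finset.univ.filter fun t : G => χ (Additive.ofMul t) = 1).card := fun e x => by
    rw [← hM e x]
    exact Finset.card_le_card (Finset.filter_subset_filter _ (Finset.subset_univ Φ))
  have hshift : ∀ (e : ℕ) (x : Π i, ZMod (p i)),
      (Φ.filter fun s => χ (Additive.ofMul s) = Complex.I ^ (e + 2) * ∏ i, χ (Additive.ofMul (u i)) ^ (x i).val).card =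
        (Finset.univ.filter fun t : G => χ (Additive.ofMul t) = 1).card -
          (Φ.filter fun s => χ (Additive.ofMul s) = Complex.I ^ e * ∏ i, χ (Additive.ofMul (u i)) ^ (x i).val).card := by
    intro e x
    have hv2 : Complex.I ^ (e + 2) * ∏ i, χ (Additive.ofMul (u i)) ^ (x i).val =
        -(Complex.I ^ e * ∏ i, χ (Additive.ofMul (u i)) ^ (x i).val) := by
      rw [pow_add, Complex.I_sq]; ring
    rw [hv2, AbelianPrimePow.card_filter_neg h χ hχρ, hM]
  -- §A  the parametrisation of `G/H` by `Fin 4 × Π ℤ/p_i` and the character sum over the value fibres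
  set wf : Fin 4 × (Π i, ZMod (p i)) → G := fun t => w₄ ^ (t.1 : ℕ) * ∏ i, u i ^ (t.2 i).val with hwf
  set F : Fin 4 × (Π i, ZMod (p i)) → ℂ := fun t =>
    Complex.I ^ (t.1 : ℕ) * ∏ i, χ (Additive.ofMul (u i)) ^ (t.2 i).val with hF
  have hFw : ∀ t, χ (Additive.ofMul (wf t)) = F t := fun t => by
    rw [hwf, hF]
    exact hval _ _
  have hFinj : Function.Injective F := by
    rintro ⟨e, x⟩ ⟨e', x'⟩ hFF
    rw [hF] at hFF
    dsimp only at hFF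
    have hx : x = x' := coords_eq_of_value_eq_fs hp hinj hodd hu hFF
    subst hx
    have hprod0 : (∏ i, χ (Additive.ofMul (u i)) ^ (x i).val) ≠ 0 :=
      Finset.prod_ne_zero_iff.2 fun i _ => pow_ne_zero _ (char_ne_zero_fs χ (u i))
    have hε : Complex.I ^ (e : ℕ) = Complex.I ^ (e' : ℕ) := mul_right_cancel₀ hprod0 hFF
    have hee : (e : ℕ) = e' := isPrimitiveRoot_I_four_fs.pow_inj e.isLt e'.isLt hε
    rw [Fin.ext hee]
  have hwinj : Function.Injective (fun t => (wf t : G ⧸ H)) := by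
    intro t t' htt
    have hmem : (wf t)⁻¹ * wf t' ∈ H := QuotientGroup.eq.1 htt
    have hχeq : χ (Additive.ofMul (wf t')) = χ (Additive.ofMul (wf t)) := (char_eq_iff_inv_mul_mem_fs χ hker _ _).2 hmem
    rw [hFw, hFw] at hχeq
    exact (hFinj hχeq).symm
  have hcard : Fintype.card (Fin 4 × (Π i, ZMod (p i))) = Fintype.card (G ⧸ H) := by
    rw [← Nat.card_eq_fintype_card (α := G ⧸ H), ← Subgroup.index_eq_card, hidx]
    simp [Fintype.card_prod, Fintype.card_pi, ZMod.card]
  have hwbij : Function.Bijective (fun t => (wf t : G ⧸ H)) :=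
    (Fintype.bijective_iff_injective_and_card _).2 ⟨hwinj, hcard⟩
  have hexists : ∀ s : G, ∃ t, χ (Additive.ofMul s) = F t := fun s => by
    obtain ⟨t, ht⟩ := hwbij.2 (s : G ⧸ H)
    refine ⟨t, ?_⟩
    rw [← hFw]
    exact (char_eq_iff_inv_mul_mem_fs χ hker (wf t) s).2 (QuotientGroup.eq.1 ht)
  have hsumF : ∑ s ∈ Φ, χ (Additive.ofMul s) =
      ∑ t : Fin 4 × (Π i, ZMod (p i)), ((Φ.filter fun s => χ (Additive.ofMul s) = F t).card : ℂ) * F t := by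
    rw [← Finset.sum_fiberwise_of_maps_to (s := Φ) (t := Finset.univ)
      (g := fun s => Classical.choose (hexists s)) (fun s _ => Finset.mem_univ _) (fun s => χ (Additive.ofMul s))]
    refine Finset.sum_congr rfl fun t _ => ?_
    have hfib : (Φ.filter fun s => Classical.choose (hexists s) = t) = Φ.filter fun s => χ (Additive.ofMul s) = F t := by
      refine Finset.filter_congr fun s _ => ⟨fun hs => ?_, fun hs => ?_⟩
      · rw [← hs]; exact Classical.choose_spec (hexists s)
      · exact hFinj ((Classical.choose_spec (hexists s)).symm.trans hs)
    rw [hfib, Finset.sum_congr rfl fun s hs => (Finset.mem_filter.1 hs).2, Finset.sum_const, nsmul_eq_mul]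
  -- the two Gaussian coordinates `E_e(x) = N(i^e Πμ^x) − N(i^{e+2} Πμ^x)`, `e = 0, 1`
  obtain ⟨D, hD⟩ : ∃ D : ℕ → (Π i, ZMod (p i)) → ℚ, ∀ (e : ℕ) (x : Π i, ZMod (p i)), D e x =
      ((Φ.filter fun s => χ (Additive.ofMul s) = Complex.I ^ e * ∏ i, χ (Additive.ofMul (u i)) ^ (x i).val).card : ℚ) -
        ((Φ.filter fun s => χ (Additive.ofMul s) = Complex.I ^ (e + 2) * ∏ i, χ (Additive.ofMul (u i)) ^ (x i).val).card : ℚ) :=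
    ⟨fun e x => ((Φ.filter fun s => χ (Additive.ofMul s) = Complex.I ^ e * ∏ i, χ (Additive.ofMul (u i)) ^ (x i).val).card : ℚ) -
        ((Φ.filter fun s => χ (Additive.ofMul s) = Complex.I ^ (e + 2) * ∏ i, χ (Additive.ofMul (u i)) ^ (x i).val).card : ℚ),
      fun _ _ => rfl⟩
  have hpair : ∑ s ∈ Φ, χ (Additive.ofMul s) =
      (∑ x : (Π i, ZMod (p i)), algebraMap ℚ ℂ (D 0 x) * ∏ i, χ (Additive.ofMul (u i)) ^ (x i).val) +
        Complex.I * ∑ x : (Π i, ZMod (p i)), algebraMap ℚ ℂ (D 1 x) * ∏ i, χ (Additive.ofMul (u i)) ^ (x i).val := by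
    rw [hsumF, Fintype.sum_prod_type, Fin.sum_univ_four, Finset.mul_sum, ← Finset.sum_add_distrib, ← Finset.sum_add_distrib,
      ← Finset.sum_add_distrib, ← Finset.sum_add_distrib]
    refine Finset.sum_congr rfl fun x _ => ?_
    rw [hD, hD, hF]
    dsimp only
    have h0 : ((0 : Fin 4) : ℕ) = 0 := rfl
    have h1 : ((1 : Fin 4) : ℕ) = 1 := rfl
    have h2 : ((2 : Fin 4) : ℕ) = 2 := rfl
    have h3 : ((3 : Fin 4) : ℕ) = 3 := rfl
    have e02 : (0 + 2 : ℕ) = 2 := rfl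
    have e12 : (1 + 2 : ℕ) = 3 := rfl
    simp only [h0, h1, h2, h3, e02, e12, pow_zero, pow_one, one_mul, Complex.I_sq, Complex.I_pow_three, neg_one_mul, map_sub,
      map_natCast]
    ring
  -- §B  `χ(S) = 0` iff both coordinates have vanishing mixed differences
  rw [hpair, sum_add_I_mul_sum_eq_zero_iff_alternatingSum hp hinj hodd hu]
  have hDval : ∀ (e : ℕ) (x : Π i, ZMod (p i)), D e x =
      2 * ((Φ.filter fun s => χ (Additive.ofMul s) = Complex.I ^ e * ∏ i, χ (Additive.ofMul (u i)) ^ (x i).val).card : ℚ) -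
        ((Finset.univ.filter fun t : G => χ (Additive.ofMul t) = 1).card : ℚ) := by
    intro e x
    rw [hD, hshift e x, Nat.cast_sub (hle e x)]
    ring
  -- the value form at base `e`: `Σ_ε (−1)^{|ε|} N(i^e Πμ^{x + εd}) = 0`
  have hvalue : ∀ e : ℕ, (∀ x d : Π i, ZMod (p i), ∑ ε : Fin k → Bool, (∏ i, (if ε i then (-1 : ℚ) else 1)) *
        D e (fun i => if ε i then x i + d i else x i) = 0) ↔
      ∀ x d : Π i, ZMod (p i), ∑ ε : Fin k → Bool, (∏ i, (if ε i then (-1 : ℚ) else 1)) *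
        ((Φ.filter fun s => χ (Additive.ofMul s) =
          Complex.I ^ e * ∏ i, χ (Additive.ofMul (u i)) ^ ((if ε i then x i + d i else x i)).val).card : ℚ) = 0 := by
    intro e
    have hrw : ∀ x d : Π i, ZMod (p i), ∑ ε : Fin k → Bool, (∏ i, (if ε i then (-1 : ℚ) else 1)) *
        D e (fun i => if ε i then x i + d i else x i) =
        2 * ∑ ε : Fin k → Bool, (∏ i, (if ε i then (-1 : ℚ) else 1)) *
          ((Φ.filter fun s => χ (Additive.ofMul s) =
            Complex.I ^ e * ∏ i, χ (Additive.ofMul (u i)) ^ ((if ε i then x i + d i else x i)).val).card : ℚ) := by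
      intro x d
      simp_rw [hDval]
      rw [Finset.mul_sum]
      have hs := sum_sign_eq_zero_fs hk
      rw [← sub_eq_zero, ← Finset.sum_sub_distrib]
      have : ∑ ε : Fin k → Bool, ((∏ i, (if ε i then (-1 : ℚ) else 1)) *
          (2 * ((Φ.filter fun s => χ (Additive.ofMul s) =
            Complex.I ^ e * ∏ i, χ (Additive.ofMul (u i)) ^ ((if ε i then x i + d i else x i)).val).card : ℚ) -
            ((Finset.univ.filter fun t : G => χ (Additive.ofMul t) = 1).card : ℚ)) -
          2 * ((∏ i, (if ε i then (-1 : ℚ) else 1)) *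
            ((Φ.filter fun s => χ (Additive.ofMul s) =
              Complex.I ^ e * ∏ i, χ (Additive.ofMul (u i)) ^ ((if ε i then x i + d i else x i)).val).card : ℚ))) =
          -((Finset.univ.filter fun t : G => χ (Additive.ofMul t) = 1).card : ℚ) *
            ∑ ε : Fin k → Bool, (∏ i, (if ε i then (-1 : ℚ) else 1)) := by
        rw [Finset.mul_sum]
        exact Finset.sum_congr rfl fun ε _ => by ring
      rw [this, hs, mul_zero]
    constructor
    · intro hv x d
      have := hv x d
      rw [hrw] at this
      linarith
    · intro hv x d
      rw [hrw, hv x d, mul_zero]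
  rw [hvalue 0, hvalue 1]
  -- the value form at base `e + 2` from that at base `e` (opposite fibres are complementary)
  have hshift_form : ∀ e : ℕ, (∀ x d : Π i, ZMod (p i), ∑ ε : Fin k → Bool, (∏ i, (if ε i then (-1 : ℚ) else 1)) *
        ((Φ.filter fun s => χ (Additive.ofMul s) =
          Complex.I ^ e * ∏ i, χ (Additive.ofMul (u i)) ^ ((if ε i then x i + d i else x i)).val).card : ℚ) = 0) →
      ∀ x d : Π i, ZMod (p i), ∑ ε : Fin k → Bool, (∏ i, (if ε i then (-1 : ℚ) else 1)) *
        ((Φ.filter fun s => χ (Additive.ofMul s) =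
          Complex.I ^ (e + 2) * ∏ i, χ (Additive.ofMul (u i)) ^ ((if ε i then x i + d i else x i)).val).card : ℚ) = 0 := by
    intro e hv x d
    have h0 := hv x d
    have hs := sum_sign_eq_zero_fs hk
    have hterm : ∀ ε : Fin k → Bool, ((Φ.filter fun s => χ (Additive.ofMul s) =
          Complex.I ^ (e + 2) * ∏ i, χ (Additive.ofMul (u i)) ^ ((if ε i then x i + d i else x i)).val).card : ℚ) =
        ((Finset.univ.filter fun t : G => χ (Additive.ofMul t) = 1).card : ℚ) -
          ((Φ.filter fun s => χ (Additive.ofMul s) =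
            Complex.I ^ e * ∏ i, χ (Additive.ofMul (u i)) ^ ((if ε i then x i + d i else x i)).val).card : ℚ) := by
      intro ε
      rw [hshift, Nat.cast_sub (hle _ _)]
    simp_rw [hterm, mul_sub, Finset.sum_sub_distrib, ← Finset.sum_mul]
    rw [hs, zero_mul, h0, sub_zero]
  -- §C  value counts versus coset counts from an arbitrary base point
  have hN : ∀ g : G, (Φ.filter fun s => g⁻¹ * s ∈ H).card =
      (Φ.filter fun s => χ (Additive.ofMul s) = χ (Additive.ofMul g)).card := fun g => by rw [hcos]
  have hcomb : ∀ (e : ℕ) (a d : Π i, ZMod (p i)) (g : G) (x : Fin k → G),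
      χ (Additive.ofMul g) = Complex.I ^ e * ∏ i, χ (Additive.ofMul (u i)) ^ (a i).val →
      (∀ i, χ (Additive.ofMul (x i)) = χ (Additive.ofMul (u i)) ^ (d i).val) →
      ∀ ε : Fin k → Bool, χ (Additive.ofMul (g * ∏ i, (if ε i then x i else 1))) =
        Complex.I ^ e * ∏ i, χ (Additive.ofMul (u i)) ^ ((if ε i then a i + d i else a i)).val := by
    intro e a d g x hg hx ε
    rw [char_mul_fs, hg, char_prod_fs, mul_assoc, ← Finset.prod_mul_distrib]
    congr 1
    refine Finset.prod_congr rfl fun i _ => ?_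
    by_cases hε : ε i
    · rw [if_pos hε, if_pos hε, hx i, pow_val_add_fs (hu i)]
    · rw [if_neg hε, if_neg hε, char_one_fs, mul_one]
  constructor
  · -- vanishing mixed differences of the two coordinates ⟹ the coset condition
    rintro ⟨hs0, hs1⟩ g x hx
    have hsAll : ∀ e : ℕ, e < 4 → ∀ a d : Π i, ZMod (p i), ∑ ε : Fin k → Bool, (∏ i, (if ε i then (-1 : ℚ) else 1)) *
        ((Φ.filter fun s => χ (Additive.ofMul s) =
          Complex.I ^ e * ∏ i, χ (Additive.ofMul (u i)) ^ ((if ε i then a i + d i else a i)).val).card : ℚ) = 0 := by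
      intro e he
      interval_cases e
      · exact hs0
      · exact hs1
      · exact hshift_form 0 hs0
      · exact hshift_form 1 hs1
    obtain ⟨⟨e, a⟩, ht⟩ := hexists g
    rw [hF] at ht
    dsimp only at ht
    have hd : ∀ i, ∃ n : ℕ, n < p i ∧ χ (Additive.ofMul (u i)) ^ n = χ (Additive.ofMul (x i)) := fun i => by
      have hxp : χ (Additive.ofMul (x i)) ^ p i = 1 := by rw [← char_pow_fs, hker]; exact hx i
      exact (hu i).eq_pow_of_pow_eq_one hxp
    choose n hn hnx using hd
    have hx' : ∀ i, χ (Additive.ofMul (x i)) = χ (Additive.ofMul (u i)) ^ (((n i : ℕ) : ZMod (p i))).val := fun i => by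
      rw [ZMod.val_natCast_of_lt (hn i), hnx]
    have key := hsAll e e.isLt a (fun i => ((n i : ℕ) : ZMod (p i)))
    have hterm : ∀ ε : Fin k → Bool,
        ((Φ.filter fun s => (g * ∏ i, (if ε i then x i else 1))⁻¹ * s ∈ H).card : ℤ) =
          ((Φ.filter fun s => χ (Additive.ofMul s) =
            Complex.I ^ (e : ℕ) * ∏ i, χ (Additive.ofMul (u i)) ^ ((if ε i then a i + ((n i : ℕ) : ZMod (p i)) else a i)).val).card : ℤ) := by
      intro ε
      rw [hN, hcomb e a _ g x ht hx' ε]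
    simp_rw [hterm]
    exact_mod_cast key
  · -- the coset condition ⟹ vanishing mixed differences of the coordinates at the base points `1` and `w`
    intro hcoset
    have hvOf : ∀ (g₀ : G) (e : ℕ), χ (Additive.ofMul g₀) = Complex.I ^ e →
        ∀ a d : Π i, ZMod (p i), ∑ ε : Fin k → Bool, (∏ i, (if ε i then (-1 : ℚ) else 1)) *
          ((Φ.filter fun s => χ (Additive.ofMul s) =
            Complex.I ^ e * ∏ i, χ (Additive.ofMul (u i)) ^ ((if ε i then a i + d i else a i)).val).card : ℚ) = 0 := by
      intro g₀ e hg₀ a d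
      have hx : ∀ i, (u i ^ (d i).val) ^ p i ∈ H := fun i => by
        rw [← hker, char_pow_fs, char_pow_fs, ← pow_mul, mul_comm, pow_mul, (hu i).pow_eq_one, one_pow]
      have key := hcoset (g₀ * ∏ i, u i ^ (a i).val) (fun i => u i ^ (d i).val) hx
      have hg : χ (Additive.ofMul (g₀ * ∏ i, u i ^ (a i).val)) = Complex.I ^ e * ∏ i, χ (Additive.ofMul (u i)) ^ (a i).val := by
        rw [char_mul_fs, hg₀, hvalu]
      have hx' : ∀ i, χ (Additive.ofMul (u i ^ (d i).val)) = χ (Additive.ofMul (u i)) ^ (d i).val := fun i => char_pow_fs χ _ _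
      have hterm : ∀ ε : Fin k → Bool,
          ((Φ.filter fun s => ((g₀ * ∏ i, u i ^ (a i).val) * ∏ i, (if ε i then u i ^ (d i).val else 1))⁻¹ * s ∈ H).card : ℤ) =
            ((Φ.filter fun s => χ (Additive.ofMul s) =
              Complex.I ^ e * ∏ i, χ (Additive.ofMul (u i)) ^ ((if ε i then a i + d i else a i)).val).card : ℤ) := by
        intro ε
        rw [hN, hcomb e a d _ _ hg hx' ε]
      simp_rw [hterm] at key
      exact_mod_cast key
    exact ⟨hvOf 1 0 (by rw [pow_zero, char_one_fs]), hvOf w₄ 1 (by rw [pow_one, hw₄])⟩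

omit [DecidableEq G] in
/-- **All characters of an index-`4p₁⋯p_k` kernel at once**: for `H ∌ ρ` with `G/H` cyclic of order `4p₁⋯p_k` (pairwise distinct odd primes,
`k ≥ 1`), the `φ(4p₁⋯p_k) = 2Π(p_i − 1)` characters with kernel `H` vanish on `S` iff the coset counts of `S` have vanishing `k`-th mixed
differences along the odd part of `G/H` from every base point (so `H` contributes `2Π(p_i − 1)` to Kubota's defect iff so). [cite: Kubota1965, §4 Lemma 2]
[cite: Hazama2003CyclicCM, Thm. 4.8] [cite: White1993SporadicCycles, §4, proof of Lemma 3 (p. 131)] [cite: LamLeung2000, Thm. 2.2] -/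
theorem forall_sum_char_eq_zero_iff_alternatingSum_of_index_four_mul_squarefree {k : ℕ} {p : Fin k → ℕ} (hk : 0 < k)
    (hp : ∀ i, (p i).Prime) (hinj : Function.Injective p) (hodd : ∀ i, p i ≠ 2)
    (h : IsCMTypeWith ρ (Φ : Set G)) {H : Subgroup G} (hρH : ρ ∉ H) (hcyc : IsCyclic (G ⧸ H))
    (hidx : H.index = 4 * ∏ i, p i) :
    (∀ χ : AddChar (Additive G) ℂ, (∀ g : G, χ (Additive.ofMul g) = 1 ↔ g ∈ H) →
        ∑ s ∈ Φ, χ (Additive.ofMul s) = 0) ↔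
      ∀ (g : G) (x : Fin k → G), (∀ i, x i ^ p i ∈ H) →
        ∑ ε : Fin k → Bool, (∏ i, (if ε i then (-1 : ℤ) else 1)) *
          ((Φ.filter fun s => (g * ∏ i, (if ε i then x i else 1))⁻¹ * s ∈ H).card : ℤ) = 0 := by
  have hρ2 := rho_mul_rho_fs h
  rw [forall_sum_char_eq_zero_iff_exists hρH hρ2 hcyc Φ]
  constructor
  · rintro ⟨ψ, hψ, h0⟩
    exact (sum_char_eq_zero_iff_alternatingSum_of_index_four_mul_squarefree hk hp hinj hodd h ψ hρH hψ hidx hcyc).1 h0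
  · intro hsep
    obtain ⟨χ, -, hker⟩ := exists_oddChar_ker hρH hρ2 hcyc
    exact ⟨χ, hker, (sum_char_eq_zero_iff_alternatingSum_of_index_four_mul_squarefree hk hp hinj hodd h χ hρH hker hidx hcyc).2 hsep⟩

end IndexFourSquarefree

/-! ## §3 (gen 65 append) The same criterion for prime families indexed by an arbitrary finite type (subsets of a prime family, as the exponent files
need them): transport along `Fintype.equivFin` -/

section Fintype

/-- **Index `4·Π_i p_i`, family indexed by a finite type `ι`**: the criterion of `sum_char_eq_zero_iff_alternatingSum_of_index_four_mul_squarefree`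
for `p : ι → ℕ` (pairwise distinct odd primes, `ι` nonempty) — the characters of kernel `H` vanish on `S` iff the `|ι|`-th mixed differences of the
coset counts vanish.  (Reindexing along `ι ≃ Fin |ι|`; this is the form used with `ι = ↥J` for a set `J` of prime divisors of the exponent.)
[cite: Kubota1965, §4 Lemma 2] [cite: Hazama2003CyclicCM, Lemma 4.6.1 and Thm. 4.8] [cite: LamLeung2000, Thm. 2.2] -/
theorem sum_char_eq_zero_iff_alternatingSum_of_index_four_mul_squarefree_fintype {ι : Type*} [Fintype ι] [DecidableEq ι]
    {p : ι → ℕ} (hne : Nonempty ι) (hp : ∀ i, (p i).Prime) (hinj : Function.Injective p) (hodd : ∀ i, p i ≠ 2)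
    (h : IsCMTypeWith ρ (Φ : Set G)) (χ : AddChar (Additive G) ℂ) {H : Subgroup G} (hρH : ρ ∉ H)
    (hker : ∀ g : G, χ (Additive.ofMul g) = 1 ↔ g ∈ H) (hidx : H.index = 4 * ∏ i, p i) (hcyc : IsCyclic (G ⧸ H)) :
    ∑ s ∈ Φ, χ (Additive.ofMul s) = 0 ↔ ∀ (g : G) (x : ι → G), (∀ i, x i ^ p i ∈ H) →
      ∑ ε : ι → Bool, (∏ i, (if ε i then (-1 : ℤ) else 1)) *
        ((Φ.filter fun s => (g * ∏ i, (if ε i then x i else 1))⁻¹ * s ∈ H).card : ℤ) = 0 := by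
  set k : ℕ := Fintype.card ι with hk
  set e : ι ≃ Fin k := Fintype.equivFin ι with he
  have hk0 : 0 < k := Fintype.card_pos_iff.2 hne
  have hidx' : H.index = 4 * ∏ i : Fin k, (p ∘ e.symm) i := by
    rw [hidx, Function.comp_def, Equiv.prod_comp e.symm p]
  rw [sum_char_eq_zero_iff_alternatingSum_of_index_four_mul_squarefree hk0 (fun i => hp (e.symm i))
    (hinj.comp e.symm.injective) (fun i => hodd (e.symm i)) h χ hρH hker hidx' hcyc]
  -- reindex the criterion along `e`
  have hre : ∀ (g : G) (x : ι → G),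
      (∑ ε : Fin k → Bool, (∏ i, (if ε i then (-1 : ℤ) else 1)) *
          ((Φ.filter fun s => (g * ∏ i, (if ε i then x (e.symm i) else 1))⁻¹ * s ∈ H).card : ℤ)) =
        ∑ ε : ι → Bool, (∏ i, (if ε i then (-1 : ℤ) else 1)) *
          ((Φ.filter fun s => (g * ∏ i, (if ε i then x i else 1))⁻¹ * s ∈ H).card : ℤ) := by
    intro g x
    rw [← Equiv.sum_comp (e.arrowCongr (Equiv.refl Bool))]
    refine Finset.sum_congr rfl fun ε _ => ?_
    have hε : ∀ i : Fin k, (e.arrowCongr (Equiv.refl Bool) ε) i = ε (e.symm i) := fun i => rfl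
    simp_rw [hε]
    rw [Equiv.prod_comp e.symm (fun j => if ε j then (-1 : ℤ) else 1),
      Equiv.prod_comp e.symm (fun j => if ε j then x j else 1)]
  constructor
  · intro hfin g x hx
    rw [← hre]
    exact hfin g (fun i => x (e.symm i)) fun i => hx (e.symm i)
  · intro hι g x hx
    have h1 := hι g (fun j => x (e j)) fun j => by simpa only [Equiv.symm_apply_apply] using hx (e j)
    rw [← hre] at h1
    simp only [Equiv.apply_symm_apply] at h1
    exact h1

omit [DecidableEq G] in
/-- **All characters at once, family indexed by a finite type** (index `4·Π_i p_i`, cyclic quotient). [cite: Kubota1965, §4 Lemma 2]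
[cite: Hazama2003CyclicCM, Thm. 4.8] [cite: White1993SporadicCycles, §4, proof of Lemma 3 (p. 131)] -/
theorem forall_sum_char_eq_zero_iff_alternatingSum_of_index_four_mul_squarefree_fintype {ι : Type*} [Fintype ι] [DecidableEq ι]
    {p : ι → ℕ} (hne : Nonempty ι) (hp : ∀ i, (p i).Prime) (hinj : Function.Injective p) (hodd : ∀ i, p i ≠ 2)
    (h : IsCMTypeWith ρ (Φ : Set G)) {H : Subgroup G} (hρH : ρ ∉ H) (hcyc : IsCyclic (G ⧸ H))
    (hidx : H.index = 4 * ∏ i, p i) :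
    (∀ χ : AddChar (Additive G) ℂ, (∀ g : G, χ (Additive.ofMul g) = 1 ↔ g ∈ H) →
        ∑ s ∈ Φ, χ (Additive.ofMul s) = 0) ↔
      ∀ (g : G) (x : ι → G), (∀ i, x i ^ p i ∈ H) →
        ∑ ε : ι → Bool, (∏ i, (if ε i then (-1 : ℤ) else 1)) *
          ((Φ.filter fun s => (g * ∏ i, (if ε i then x i else 1))⁻¹ * s ∈ H).card : ℤ) = 0 := by
  have hρ2 := rho_mul_rho_fs h
  rw [forall_sum_char_eq_zero_iff_exists hρH hρ2 hcyc Φ]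
  constructor
  · rintro ⟨ψ, hψ, h0⟩
    exact (sum_char_eq_zero_iff_alternatingSum_of_index_four_mul_squarefree_fintype hne hp hinj hodd h ψ hρH hψ hidx hcyc).1 h0
  · intro hsep
    obtain ⟨χ, -, hker⟩ := exists_oddChar_ker hρH hρ2 hcyc
    exact ⟨χ, hker, (sum_char_eq_zero_iff_alternatingSum_of_index_four_mul_squarefree_fintype hne hp hinj hodd h χ hρH hker hidx hcyc).2 hsep⟩

end Fintype

end AbelianKernels

end CyclicCMType

end Literature.NumberTheory.ComplexMultiplication

end
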